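import Literature.Analysis.Potential.HyperbolicPoissonKernelEq531Proofs
import HarnessLib

/-!
# Discharge of Stoll's Lemma 5.3.1(c): `⨍_𝕊 P_h(x,t) dσ(t) = 1`

Source: M. Stoll, *Harmonic and Subharmonic Function Theory on the Hyperbolic Ball*, LMS Lecture
Note Series 431, CUP 2016 [Stoll2016], Lemma 5.3.1(c) (§5.3): for `x` in the unit ball of `ℝⁿ`,
`n ≥ 2`, the invariant Poisson kernel `P_h(x,t) = ((1 - |x|²)/|t - x|²)^(n-1)` (5.1.5) has
`σ`-average `1` over the unit sphere. This file proves the named fact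
`Literature.Analysis.Potential.Stoll2016_lemma531c` of `HyperbolicPoissonKernel.lean`
(`Stoll2016_lemma531c_holds`).

## Proof (deviates from the printed one)

The printed proof — "(c) follows by (b) `P_h(rζ,t) = P_h(rt,ζ)` and the mean-value property for
𝓗-harmonic functions" — needs Chapters 3–4 of the book (invariant measure, invariant mean-value
property), a theory Mathlib does not have. Instead, Lemma 5.3.1(c) is the case `f ≡ 1` of the
Möbius change of variables on the sphere, Stoll's (5.3.1)
`∫_𝕊 f(φ_x(t)) dσ(t) = ∫_𝕊 P_h(x,t) f(t) dσ(t)`, which is already discharged in this directory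
(`Stoll2016_eq531_holds`, file `HyperbolicPoissonKernelEq531Proofs.lean`, by the Euclidean
change-of-variables formula for the radial extension of `φ_x|_𝕊` and polar coordinates):
`σ(𝕊) = ∫_𝕊 1 dσ = ∫_𝕊 P_h(x,t) dσ(t)`, and `0 < σ(𝕊) < ∞`. (An independent toolbox for the same
change of variables, phrased for a general real inner product space, is `SphereChordMap.lean`.)
-/

noncomputable section

open MeasureTheory Metric Set

namespace Literature.Analysis.Potential

open HyperbolicBall in
/-- **Stoll 2016, Lemma 5.3.1 (c)** — discharge of the named fact `Stoll2016_lemma531c`: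
for `n ≥ 2` and `x` in the open unit ball of `ℝⁿ`, `⨍_𝕊 P_h(x,t) dσ(t) = 1`, where
`P_h(x,t) = ((1 - |x|²)/|t - x|²)^(n-1)` is the invariant Poisson kernel and `σ` the surface
measure `volume.toSphere` on the unit sphere. Obtained from (5.3.1) (`Stoll2016_eq531_holds`)
with `f ≡ 1`, not by the printed route through the invariant mean-value property.
[cite: Stoll2016, Lemma 5.3.1(c)] -/
theorem Stoll2016_lemma531c_holds : Stoll2016_lemma531c := by
  intro n hn x hx
  haveI : Nontrivial (EuclideanSpace ℝ (Fin n)) :=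
    Module.nontrivial_of_finrank_pos (R := ℝ) (by rw [finrank_euclideanSpace_fin]; omega)
  -- (5.3.1) with `f ≡ 1`: `σ.real univ = ∫ P_h(x, t) dσ(t)`
  have h := Stoll2016_eq531_holds n hn x hx (fun _ => (1 : ℝ)) (integrable_const 1)
  simp only [mul_one, integral_const, smul_eq_mul] at h
  have hσ0 : (volume : Measure (EuclideanSpace ℝ (Fin n))).toSphere.real univ ≠ 0 := by
    rw [measureReal_def]
    exact ENNReal.toReal_ne_zero.mpr
      ⟨Measure.measure_univ_ne_zero.mpr (Measure.toSphere_ne_zero _), measure_ne_top _ _⟩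
  rw [average_eq, smul_eq_mul, ← h, inv_mul_cancel₀ hσ0]

end Literature.Analysis.Potential

end
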